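import Summits.QuantumFields.YangMills.Theorems.BalabanUVNodesN19MomentBudgetLinearParameters
import Summits.QuantumFields.YangMills.Theorems.BalabanUVNodesN19LipschitzLinksMomentBudgetLogSq

/-!
# YM-DAG node N19 (= NE7 proper) — EVERY LIPSCHITZ LINK OF THE ℓ¹-NORM IN THE UNIFORM MIXED-MOMENT CURRENCY, AT THE RIDGE RATE UP TO ONE LOGARITHM
# (laws with `e^{−L}`-close mixed moments: `|∫h(Σ|x_i|)dP − ∫h(Σ|x_i|)dQ| ≤ 3.5·10⁵·K·d·log₂L∕L` — module 170 with the ladder re-balanced)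

Cell `pub-ymgap`, HUMAN RULING D-0062 (Track A) ∕ D-0149 (work-bound push), R141 (C) wider-strategy seat `pub-ymgap-dag-n19-e` (strategy
s3 = ALTERNATIVE CURRENCY), generation g34, module 5 (lineage module 180).  Route `Summits/QuantumFields/YangMills/Theses/BalabanUVNodes.lean`,
cluster item K3⁸ «SpineGivenEndpointR13SepCoPHV» (stmt-QuantumFields-27366); filed `--supports` that item `--as helper` (it proves no registered
stub).  COUNT-NEUTRAL: [folklore]∕[bookkeeping] over Mathlib and the lineage BY NAME — module 179 `…N19MomentBudgetLinearParameters`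
(`logb_le_L20`, `exists_parameters_L1`, `errorBound_L1`), module 155 `…N19LipschitzLinksMomentFirstOrder`
(`exists_mvPolynomial_near_trigLink_firstOrder_mass`), module 167 `…N19LipschitzLinkJacksonSmoothing` (`exists_trigLink_near_lipschitzLink_jackson`),
module 145 (`abs_integral_sub_le_of_near_mass`), modules 125 ∕ 120 ∕ 66 (`continuous_l1Norm`, `l1Norm_mem_Icc`, `integrable_of_continuous_of_cube`);
TOY laws under HYPOTHESES; no scheme object, no Theses import; NOT a discharge claim.

THE RESULT.  ★★★ `abs_integral_lipschitzLink_l1Norm_sub_le_of_closeMoments_log` — **for probability laws `P, Q` on `ℝ^ι` carried by `[−1,1]^ι` with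
`|∫∏x_i^{j_i}dP − ∫∏x_i^{j_i}dQ| ≤ e^{−L}` for every multi-index `j`, `L ≥ 2^20`, and every `h` with `|h(s) − h(s′)| ≤ K|s − s′|` on `ℝ` (`K ≥ 0`):
`|∫h(Σ_i|x_i|)dP − ∫h(Σ_i|x_i|)dQ| ≤ 3.5·10⁵·K·d·log₂L∕L`** (`d = |ι| ≥ 1`) — module 170 (`3·10⁶·K·d·log₂²L∕L`, `L ≥ 2^28`) with ONE logarithm
(and from `2^20` on); two-sided up to that logarithm by module 138 (a pair with `e^{−L}`-close moments and `≥ d·log 2∕(10π·L)`).  PROOF: module 170's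
verbatim with module 179's parameters (`h(S) − h(0)`; module 155's polynomial with mass `≤ (π⁴KdL_F∕8)·e^{L∕2}`; module 145's price
`2·sup + mass·e^{−L}` with `(π⁴KdL_F∕8)e^{−L∕2} ≤ π⁴Kd∕L`).

HONEST FRAMING (binding).  Elementary and [folklore]; TOY laws under hypotheses; constants astronomical (`3.5·10⁵`, `2^20`), nowhere optimised; NO
consumer in the DAG today (the seat's own currency map); nothing of Bałaban's instantiated; NE7 NOT PRINTED, NOT proved; N19 NOT discharged;
count-neutral.  One finite `T⁴` programme at fixed `ε`; nothing continuum ∕ `ℝ⁴` ∕ OS ∕ mass-gap ∕ Clay.  0 `def` ∕ 0 `sorry`.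
-/

noncomputable section

open Finset MeasureTheory
open scoped Real

namespace Summit.QuantumFields.YangMills.Theorems.BalabanUVNodesN19LipschitzLinksMomentBudgetLog

open Summit.QuantumFields.YangMills.Theorems.BalabanUVNodesN19MomentBudgetLinearParameters (logb_le_L20 exists_parameters_L1 errorBound_L1)
open Summit.QuantumFields.YangMills.Theorems.BalabanUVNodesN19LipschitzLinksMomentFirstOrder (exists_mvPolynomial_near_trigLink_firstOrder_mass)
open Summit.QuantumFields.YangMills.Theorems.BalabanUVNodesN19LipschitzLinkJacksonSmoothing (exists_trigLink_near_lipschitzLink_jackson)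
open Summit.QuantumFields.YangMills.Theorems.BalabanUVNodesN19SingleModeMomentLogFreeBudget (abs_integral_sub_le_of_near_mass)
open Summit.QuantumFields.YangMills.Theorems.BalabanUVNodesN19OscillatingLinksMomentDiscrepancy (continuous_l1Norm)
open Summit.QuantumFields.YangMills.Theorems.BalabanUVNodesN19OscillatingLinksMultiscale (l1Norm_mem_Icc)
open Summit.QuantumFields.YangMills.Theorems.BalabanUVNodesN19JointLawBernstein (integrable_of_continuous_of_cube)

variable {ι : Type*} [Fintype ι]

/-! ## ★★★ Every Lipschitz link in the uniform mixed-moment currency, up to one logarithm [folklore] -/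

variable [Nonempty ι]

/-- ★★★ **EVERY LIPSCHITZ LINK OF THE ℓ¹-NORM OF `d` STRINGS, IN THE UNIFORM MIXED-MOMENT CURRENCY, AT THE RIDGE RATE UP TO ONE LOGARITHM.**  Let
`P, Q` be probability laws on `ℝ^ι` carried by `[−1,1]^ι` (finite nonempty `ι`, `d = |ι|`) with `|∫∏x_i^{j_i}dP − ∫∏x_i^{j_i}dQ| ≤ e^{−L}` for every
multi-index `j`, `L ≥ 2^20`, and let `h : ℝ → ℝ` satisfy `|h(s) − h(s′)| ≤ K|s − s′|` on `ℝ` (`K ≥ 0`).  Then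
**`|∫h(Σ_i|x_i|)dP − ∫h(Σ_i|x_i|)dQ| ≤ 350000·K·d·log₂L∕L`.**  PROOF: module 170's verbatim with module 179's re-balanced parameters (`h(S) − h(0)`; module
155's polynomial with mass `≤ (π⁴KdL_F∕8)·e^{L∕2}`; module 145's price `2·sup + mass·e^{−L}` with module 179's bookkeeping and `(π⁴KdL_F∕8)e^{−L∕2} ≤ π⁴Kd∕L`).
Two-sided up to ONE logarithm by module 138 (`≥ d·log 2∕(10π·L)` for a pair with `e^{−L}`-close moments). [folklore] -/
theorem abs_integral_lipschitzLink_l1Norm_sub_le_of_closeMoments_log {P Q : Measure (ι → ℝ)} [IsProbabilityMeasure P] [IsProbabilityMeasure Q]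
    (hP : P (Set.pi Set.univ (fun _ : ι => Set.Icc (-1 : ℝ) 1))ᶜ = 0) (hQ : Q (Set.pi Set.univ (fun _ : ι => Set.Icc (-1 : ℝ) 1))ᶜ = 0)
    {L : ℝ} (hL : (2 : ℝ) ^ (20 : ℕ) ≤ L) (hmom : ∀ j : ι → ℕ, |∫ x, ∏ i, x i ^ j i ∂P - ∫ x, ∏ i, x i ^ j i ∂Q| ≤ Real.exp (-L))
    {h : ℝ → ℝ} {K : ℝ} (hK0 : 0 ≤ K) (hK : ∀ s s', |h s - h s'| ≤ K * |s - s'|) :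
    |∫ x, h (∑ i, |x i|) ∂P - ∫ x, h (∑ i, |x i|) ∂Q| ≤ 350000 * K * Fintype.card ι * Real.logb 2 L / L := by
  set d : ℝ := (Fintype.card ι : ℝ) with hdd
  have hd : 0 < d := by rw [hdd]; exact_mod_cast Fintype.card_pos
  have hL0 : 0 < L := lt_of_lt_of_le (by positivity) hL
  have hLge : (1048576 : ℝ) ≤ L := le_trans (by norm_num) hL
  obtain ⟨hΛ20, _, _⟩ := logb_le_L20 hL
  obtain ⟨LF, J, hh, N, hLF1, hLLF, hLFL, hh1, hJh, hexph, hJ1, hLππ, hNJ, hN17, hbudget⟩ := exists_parameters_L1 hL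
  have hLFr : (1 : ℝ) ≤ LF := by exact_mod_cast hLF1
  have hLFL' : (LF : ℝ) ≤ L := by
    have h1 : (1 : ℝ) ≤ 12000 * Real.logb 2 L := by nlinarith only [hΛ20]
    exact (le_mul_of_one_le_left (by positivity) h1).trans hLFL
  -- the smoothing of the link on `[0, d]`
  have hK' : ∀ s s', s ∈ Set.Icc (0 : ℝ) d → s' ∈ Set.Icc (0 : ℝ) d → |h s - h s'| ≤ K * |s - s'| := fun s s' _ _ => hK s s'
  obtain ⟨α, β, ω, g, g₁, hω0, hωΩ, hW, hg, hg₁, hC11, hB1, herr⟩ := exists_trigLink_near_lipschitzLink_jackson hd hK0 hK' hLF1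
  have hΩ : (0 : ℝ) ≤ 2 * LF * π / d := by positivity
  -- the polynomial with mass
  obtain ⟨F, hFmass, hFerr⟩ := exists_mvPolynomial_near_trigLink_firstOrder_mass (ι := ι)
    (((range LF ×ˢ range LF) ×ˢ (range LF ×ˢ range LF)) ×ˢ (Finset.univ : Finset Bool)) (h 0) α β ω
    (Ω := 2 * LF * π / d) (W := π ^ 4 * (K * d) * LF / 8) (B₁ := K) (B₂ := K * π * LF / d) hg hg₁ hΩ hω0 hωΩ hW hC11 hB1 J hh N hh1 hJh hNJ
  -- the sup error on the cube
  have hS := fun (x : ι → ℝ) (hx : ∀ i, x i ∈ Set.Icc (-1 : ℝ) 1) => l1Norm_mem_Icc x hx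
  have hε : 2 * ((J : ℝ) + 1) * Real.exp (-(hh : ℝ)) ≤ 1 / (2 * L ^ 2) := by
    calc 2 * ((J : ℝ) + 1) * Real.exp (-(hh : ℝ)) ≤ 2 * (L / 4) * (1 / L ^ 3) := by
          have := mul_le_mul hJ1 hexph (Real.exp_pos _).le (by positivity)
          linarith only [this]
      _ = 1 / (2 * L ^ 2) := by field_simp; ring
  have hNJr : ((2 : ℝ) ^ J) ≤ N := by exact_mod_cast hNJ
  have hη := errorBound_L1 (M := (2 : ℝ) ^ J) (ε := 2 * ((J : ℝ) + 1) * Real.exp (-(hh : ℝ))) hK0 hd hLge hΛ20 hLFr hLFL' hLLF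
    hLππ hNJr hN17 hε
  have happ : ∀ x : ι → ℝ, (∀ i, x i ∈ Set.Icc (-1 : ℝ) 1) →
      |(h (∑ i, |x i|) - h 0) - MvPolynomial.eval x F| ≤ 171700 * K * d * Real.logb 2 L / L := by
    intro x hx
    have h1 := herr (∑ i, |x i|) (by rw [hdd]; exact ⟨(hS x hx).1, (hS x hx).2⟩)
    have h2 := hFerr x hx
    rw [← hdd] at h2
    calc |(h (∑ i, |x i|) - h 0) - MvPolynomial.eval x F|
        ≤ |h (∑ i, |x i|) - g (∑ i, |x i|)| + |(g (∑ i, |x i|) - h 0) - MvPolynomial.eval x F| := by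
          have e : (h (∑ i, |x i|) - h 0) - MvPolynomial.eval x F =
              (h (∑ i, |x i|) - g (∑ i, |x i|)) + ((g (∑ i, |x i|) - h 0) - MvPolynomial.eval x F) := by ring
          rw [e]; exact abs_add_le _ _
      _ ≤ _ := add_le_add h1 h2
      _ ≤ 171700 * K * d * Real.logb 2 L / L := hη
  -- the mass budget: `mass F · e^{−L} ≤ (π⁴KdL_F/8) · e^{−L/2} ≤ π⁴Kd/L`
  have hmass : (∑ s ∈ F.support, |F.coeff s|) * Real.exp (-L) ≤ π ^ 4 * K * d / L := by
    have hW0 : 0 ≤ π ^ 4 * (K * d) * (LF : ℝ) / 8 := by positivity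
    have e : 2 * LF * π / d * (Fintype.card ι : ℝ) = 2 * LF * π := by rw [← hdd]; field_simp
    rw [e] at hFmass
    have h1 : (∑ s ∈ F.support, |F.coeff s|) ≤ π ^ 4 * (K * d) * LF / 8 * Real.exp (L / 2) := by
      refine hFmass.trans ?_
      rw [mul_assoc]
      refine mul_le_mul_of_nonneg_left ?_ hW0
      rw [← Real.exp_log (show (0 : ℝ) < 1 + 2 * (2 * LF * π) * (N * 9 ^ N) by positivity), ← Real.exp_add]
      exact Real.exp_le_exp.2 hbudget
    have h2 : L ^ 2 * Real.exp (-(L / 2)) ≤ 8 := by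
      have h3 : (L / 2) ^ 2 / 2 ≤ Real.exp (L / 2) := by
        have := Real.quadratic_le_exp_of_nonneg (show 0 ≤ L / 2 by positivity)
        linarith
      rw [Real.exp_neg]
      have h4 : 0 < Real.exp (L / 2) := Real.exp_pos _
      rw [mul_inv_le_iff₀ h4]
      nlinarith only [h3]
    calc (∑ s ∈ F.support, |F.coeff s|) * Real.exp (-L) ≤ π ^ 4 * (K * d) * LF / 8 * Real.exp (L / 2) * Real.exp (-L) :=
          mul_le_mul_of_nonneg_right h1 (Real.exp_pos _).le
      _ = π ^ 4 * (K * d) * LF / 8 * Real.exp (-(L / 2)) := by rw [mul_assoc, ← Real.exp_add]; ring_nf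
      _ ≤ π ^ 4 * (K * d) * L / 8 * Real.exp (-(L / 2)) := by
          have := mul_le_mul_of_nonneg_right hLFL' (by positivity : (0 : ℝ) ≤ π ^ 4 * (K * d) / 8 * Real.exp (-(L / 2)))
          nlinarith only [this]
      _ = π ^ 4 * (K * d) / 8 / L * (L ^ 2 * Real.exp (-(L / 2))) := by field_simp
      _ ≤ π ^ 4 * (K * d) / 8 / L * 8 := mul_le_mul_of_nonneg_left h2 (by positivity)
      _ = π ^ 4 * K * d / L := by ring
  -- the price
  have hLip : LipschitzWith (Real.toNNReal K) h := by
    refine LipschitzWith.of_dist_le_mul fun x y => ?_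
    rw [Real.dist_eq, Real.dist_eq, Real.coe_toNNReal _ hK0]
    exact hK x y
  have hcont : Continuous fun x : ι → ℝ => h (∑ i, |x i|) := hLip.continuous.comp continuous_l1Norm
  have hg0 : Continuous fun x : ι → ℝ => h (∑ i, |x i|) - h 0 := hcont.sub continuous_const
  have hprice := abs_integral_sub_le_of_near_mass hP hQ (Real.exp_pos _).le hmom hg0 happ le_rfl
  -- the constant integrates to zero difference
  have hconst : ∫ x, h (∑ i, |x i|) ∂P - ∫ x, h (∑ i, |x i|) ∂Q =
      ∫ x, (h (∑ i, |x i|) - h 0) ∂P - ∫ x, (h (∑ i, |x i|) - h 0) ∂Q := by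
    rw [integral_sub (integrable_of_continuous_of_cube hP hcont) (integrable_const _),
      integral_sub (integrable_of_continuous_of_cube hQ hcont) (integrable_const _)]
    simp only [MeasureTheory.integral_const, smul_eq_mul, probReal_univ]
    ring
  rw [hconst]
  refine hprice.trans ?_
  have hKd : 0 ≤ K * d := mul_nonneg hK0 hd.le
  have hπ4 : π ^ 4 ≤ 98.5 := by
    have hπhi : π < 3.15 := Real.pi_lt_d2
    have hπ2 : π ^ 2 < 3.15 * 3.15 := by rw [pow_two]; exact mul_lt_mul'' hπhi hπhi Real.pi_pos.le Real.pi_pos.le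
    nlinarith only [hπ2, pow_pos Real.pi_pos 2]
  have e : 2 * (171700 * K * d * Real.logb 2 L / L) + π ^ 4 * K * d / L =
      (343400 * K * d * Real.logb 2 L + π ^ 4 * K * d) / L := by ring
  rw [hdd] at hmass e ⊢
  calc 2 * (171700 * K * (Fintype.card ι : ℝ) * Real.logb 2 L / L) + (∑ s ∈ F.support, |F.coeff s|) * Real.exp (-L)
      ≤ 2 * (171700 * K * (Fintype.card ι : ℝ) * Real.logb 2 L / L) + π ^ 4 * K * (Fintype.card ι : ℝ) / L := add_le_add le_rfl hmass
    _ = (343400 * K * (Fintype.card ι : ℝ) * Real.logb 2 L + π ^ 4 * K * (Fintype.card ι : ℝ)) / L := e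
    _ ≤ 350000 * K * Fintype.card ι * Real.logb 2 L / L := by
        refine div_le_div_of_nonneg_right ?_ hL0.le
        rw [← hdd]
        have hx : π ^ 4 * K * d ≤ 98.5 * (K * d) := by
          have := mul_le_mul_of_nonneg_right hπ4 hKd
          linarith only [this, show π ^ 4 * K * d = π ^ 4 * (K * d) by ring]
        nlinarith only [hKd, hΛ20, hx]

end Summit.QuantumFields.YangMills.Theorems.BalabanUVNodesN19LipschitzLinksMomentBudgetLog

end
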